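/-
Copyright (c) 2026 the pub-hodgecm-mathlib formalisation cell (harness21).  Prover seat hodgecm-mathlib-LH4-p01 (g12): road M6 → F5 → dyadic chain of `stub_DyUnramCore` (D-UNR),
site (L2-3) «THE WALL», residual algebra under CM-carrier row 3 «N3-θ» of CENSUS-L23-CM v1 (LH10-p01 (g12)); 2026-09-03.
-/
import Literature.NumberTheory.Automorphic.ResidualMoebiusShiftRank   -- ★ N3 FILE 1 (F0P2-p01 (g14)): the `|2| = 1` residual shift algebra (pattern); brings ★ `redMat` API, `red_eq_zero_of_valuation_lt_one`, `rank_lt_of_pow_eq_zero`, `pow_card_redMat_eq_zero_of_charpoly_eq`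
import HarnessLib

/-!
# Residual algebra of the HERMITIAN Möbius shift: `red(φ_θ(1 + cA)) − 1 = Ā(1 − θ̄′Ā)⁻¹` — nilpotency and rank are kept at EVERY residue characteristic (Kottwitz 1986 §3;
# Rogawski 1990 §4.9)

Topic `NumberTheory/Automorphic`; namespace `Literature.NumberTheory.Automorphic`.  THEOREMS ONLY (no definition, no instance, no notation, no named fact, no `sorry`); generic
`[Field F] [ValuativeRel F]`, any size `n`; kernel lane `--supports stmt-HodgeConjecture-24833`.  Cell `pub/hodgecm-mathlib` (D-0151), crux H413 = `stmt-HodgeConjecture-24833`; road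
M6 → F5 → the dyadic chain of organ (D-UNR) `stub_DyUnramCore`, LEVEL TWO, site (L2-3) «THE WALL» = ★ `liftInterior_of_levelTwo` with `h2` deleted; CM-carrier row 3 «N3-θ» of
LH10-p01 (g12)'s CENSUS-L23-CM v1.  ★ FILE 1 `ResidualMoebiusShiftRank` does this for the σ-fixed shift `φ_c(1 + cA) = (2 + (c+1)A)(2 + (c−1)A)⁻¹`, where `red M − 1 = 2Ā(2 − Ā)⁻¹`
needs `2 ≠ 0` in the residue field.  For the HERMITIAN shift (LH10-p01 MEMO-L23-θSHIFT; ★ P3 `hermitianMoebius_one_add_smul_eq`: `φ_θ(1 + c•A) = (1 + θ•A)(1 + (c−θ′)•A)⁻¹`,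
`θ + θ′ = 1`, both integral) the residual identity is
  `red M · (1 − θ̄′Ā) = 1 + θ̄Ā`, hence **`red M − 1 = (θ̄ + θ̄′)Ā(1 − θ̄′Ā)⁻¹ = Ā(1 − θ̄′Ā)⁻¹`**
with `1 − θ̄′Ā` unipotent-invertible for nilpotent `Ā` — NO `2` anywhere.  So `(red M − 1)^k = 0` whenever `Ā^k = 0`, and `rank(red M − 1) = rank Ā`: the residual Jordan
stratum of `φ_θ(z)` IS the interior stratum of `z`, at every residue characteristic.
HONEST LABEL: HC_CM is proved only modulo the 7 printed citations (2 remaining: hLiu418 = stmt-HodgeConjecture-24832, h413 = stmt-HodgeConjecture-24833) until rung 0 closes;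
count-neutral residual algebra; nothing printed is asserted here.

* §1 `redMat_one_add_smul` (`red(1 + tA) = 1 + t̄Ā`), `isUnit_one_add_smul_of_isNilpotent`, `valuation_det_one_add_smul_eq_one` (`det(1 + tA)` is a unit for nilpotent `Ā`);
* §2 `redMat_mul_one_sub_eq_one_add` (the reduced shift identity), **`redMat_sub_one_eq_of_hermitianShift`**, **`pow_redMat_sub_one_eq_zero_of_hermitianShift`**,
  **`rank_redMat_sub_one_eq_of_hermitianShift`**.

## References
* [Kottwitz1986BaseChangeUnits] R. E. Kottwitz, *Base change for unit elements of Hecke algebras*, Compositio Math. 60 (1986): §3 (the shift on fixed lattices).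
* [Rogawski1990] J. D. Rogawski, *Automorphic Representations of Unitary Groups in Three Variables*, Ann. of Math. Stud. 123 (1990): §4.9 Prop. 4.9.1 p. 55, §3.9 p. 32.
* [Serre1980Trees] J.-P. Serre, *Trees* (1980): Ch. II §1.1–1.2.
-/

set_option autoImplicit false

noncomputable section

open scoped Matrix MatrixGroups ValuativeRel Polynomial
open Matrix ValuativeRel Polynomial

namespace Literature.NumberTheory.Automorphic

open Literature.NumberTheory.Automorphic.IntegralReduction

variable {F : Type*} [Field F] [ValuativeRel F] {n : ℕ}

/-! ## §1 Reduction of `1 + tA` and its unit determinant -/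

/-- `red (1 + t·A) = 1 + red t · red A` for integral `A`, `t`. [cite: Kottwitz1986BaseChangeUnits, §3] -/
theorem redMat_one_add_smul {A : Matrix (Fin n) (Fin n) F} (hA : ValBound 1 A) {t : F} (ht : valuation F t ≤ 1) :
    redMat ((1 : Matrix (Fin n) (Fin n) F) + t • A) = (1 : Matrix (Fin n) (Fin n) 𝓀[F]) + red t • redMat A := by
  have htO : t ∈ 𝒪[F] := (Valuation.mem_integer_iff _ _).2 ht
  have hb2 : ValBound 1 (t • A) := fun i j => by
    rw [Matrix.smul_apply, smul_eq_mul, map_mul]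
    exact mul_le_one' ht (hA i j)
  rw [redMat_add valBound_one hb2, redMat_smul htO hA, redMat_one]

/-- `1 + s·N` is a unit for nilpotent `N` (any field, any characteristic). [cite: Kottwitz1986BaseChangeUnits, §3] -/
theorem isUnit_one_add_smul_of_isNilpotent {k : Type*} [Field k] {N : Matrix (Fin n) (Fin n) k} (hN : IsNilpotent N) (s : k) :
    IsUnit ((1 : Matrix (Fin n) (Fin n) k) + s • N) := by
  have hsN : IsNilpotent (s • N) := by
    obtain ⟨m, hm⟩ := hN
    exact ⟨m, by rw [_root_.smul_pow, hm, smul_zero]⟩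
  exact hsN.isUnit_one_add

/-- **`det(1 + tA)` is a unit** for integral `A` with nilpotent reduction and integral `t` (any residue characteristic): its reduction `det(1 + t̄Ā)` is non-zero.
[cite: Kottwitz1986BaseChangeUnits, §3] -/
theorem valuation_det_one_add_smul_eq_one {A : Matrix (Fin n) (Fin n) F} (hA : ValBound 1 A) (hnil : IsNilpotent (redMat A)) {t : F} (ht : valuation F t ≤ 1) :
    valuation F ((1 : Matrix (Fin n) (Fin n) F) + t • A).det = 1 := by
  have hb : ValBound 1 ((1 : Matrix (Fin n) (Fin n) F) + t • A) := fun i j => by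
    rw [Matrix.add_apply, Matrix.smul_apply, smul_eq_mul]
    refine Valuation.map_add_le _ (valBound_one i j) ?_
    rw [map_mul]; exact mul_le_one' ht (hA i j)
  refine valuation_eq_one_of_red_ne_zero ((Valuation.mem_integer_iff _ _).2 (valuation_det_le_one hb)) ?_
  rw [red_det hb, redMat_one_add_smul hA ht]
  exact ((isUnit_one_add_smul_of_isNilpotent hnil (red t)).map Matrix.detMonoidHom).ne_zero

/-! ## §2 The reduction of the hermitian shift: `red(φ_θ z) − 1 = Ā(1 − θ̄′Ā)⁻¹`, nilpotency and rank -/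

/-- **THE RESIDUAL HERMITIAN SHIFT**: if `M·(1 + (c−θ′)A) = 1 + θA` (`M = φ_θ(1 + cA)`, ★ P3 `hermitianMoebius_one_add_smul_eq`) with `M, A, θ, θ′` integral and `|c| < 1`, then
`red M · (1 − θ̄′·Ā) = 1 + θ̄·Ā` (`red c = 0`). [cite: Kottwitz1986BaseChangeUnits, §3] -/
theorem redMat_mul_one_sub_eq_one_add {M A : Matrix (Fin n) (Fin n) F} (hM : ValBound 1 M) (hA : ValBound 1 A) {c θ θ' : F} (hc : valuation F c < 1)
    (hθ : valuation F θ ≤ 1) (hθ' : valuation F θ' ≤ 1)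
    (hMB : M * ((1 : Matrix (Fin n) (Fin n) F) + (c - θ') • A) = (1 : Matrix (Fin n) (Fin n) F) + θ • A) :
    redMat M * ((1 : Matrix (Fin n) (Fin n) 𝓀[F]) - red θ' • redMat A) = (1 : Matrix (Fin n) (Fin n) 𝓀[F]) + red θ • redMat A := by
  have hc1 : valuation F c ≤ 1 := hc.le
  have hct : valuation F (c - θ') ≤ 1 := (Valuation.map_sub _ _ _).trans (max_le hc1 hθ')
  have hB : ValBound 1 ((1 : Matrix (Fin n) (Fin n) F) + (c - θ') • A) := fun i j => by
    rw [Matrix.add_apply, Matrix.smul_apply, smul_eq_mul]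
    refine Valuation.map_add_le _ (valBound_one i j) ?_
    rw [map_mul]; exact mul_le_one' hct (hA i j)
  have hcO : c ∈ 𝒪[F] := (Valuation.mem_integer_iff _ _).2 hc1
  have hθ'O : θ' ∈ 𝒪[F] := (Valuation.mem_integer_iff _ _).2 hθ'
  have hredc : red c = 0 := red_eq_zero_of_valuation_lt_one hc
  have hredct : red (c - θ') = -red θ' := by
    have e : red (c - θ') = IsLocalRing.residue 𝒪[F] ((⟨c, hcO⟩ : 𝒪[F]) - ⟨θ', hθ'O⟩) := red_coe ((⟨c, hcO⟩ : 𝒪[F]) - ⟨θ', hθ'O⟩)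
    have e' : red c = IsLocalRing.residue 𝒪[F] (⟨c, hcO⟩ : 𝒪[F]) := red_coe (⟨c, hcO⟩ : 𝒪[F])
    have e'' : red θ' = IsLocalRing.residue 𝒪[F] (⟨θ', hθ'O⟩ : 𝒪[F]) := red_coe (⟨θ', hθ'O⟩ : 𝒪[F])
    rw [e, map_sub, ← e', ← e'', hredc, zero_sub]
  have h := congrArg redMat hMB
  rw [redMat_mul hM hB, redMat_one_add_smul hA hct, redMat_one_add_smul hA hθ, hredct, neg_smul, ← sub_eq_add_neg] at h
  exact h

/-- **`red(φ_θ z) − 1 = Ā·(1 − θ̄′·Ā)⁻¹`** for `θ + θ′ = 1` (`Ā = red A` nilpotent, so `1 − θ̄′Ā` is invertible; `(1 + θ̄Ā) − (1 − θ̄′Ā) = (θ̄ + θ̄′)Ā = Ā`).  ★ `redMat_sub_one_eq_of_shift` is the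
`|2| = 1` version `2Ā(2 − Ā)⁻¹`. [cite: Kottwitz1986BaseChangeUnits, §3] [cite: Rogawski1990, §4.9 Prop. 4.9.1 p. 55] -/
theorem redMat_sub_one_eq_of_hermitianShift {M A : Matrix (Fin n) (Fin n) F} (hM : ValBound 1 M) (hA : ValBound 1 A) (hnil : IsNilpotent (redMat A)) {c θ θ' : F}
    (hc : valuation F c < 1) (hθ : valuation F θ ≤ 1) (hθ' : valuation F θ' ≤ 1) (hθθ' : θ + θ' = 1)
    (hMB : M * ((1 : Matrix (Fin n) (Fin n) F) + (c - θ') • A) = (1 : Matrix (Fin n) (Fin n) F) + θ • A) :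
    redMat M - 1 = redMat A * ((1 : Matrix (Fin n) (Fin n) 𝓀[F]) - red θ' • redMat A)⁻¹ := by
  have hD : IsUnit ((1 : Matrix (Fin n) (Fin n) 𝓀[F]) - red θ' • redMat A) := by
    have h := isUnit_one_add_smul_of_isNilpotent hnil (-red θ')
    rwa [neg_smul, ← sub_eq_add_neg] at h
  have hDdet : IsUnit ((1 : Matrix (Fin n) (Fin n) 𝓀[F]) - red θ' • redMat A).det := (Matrix.isUnit_iff_isUnit_det _).1 hD
  have key := redMat_mul_one_sub_eq_one_add hM hA hc hθ hθ' hMB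
  -- `θ̄ + θ̄′ = 1`
  have hθO : θ ∈ 𝒪[F] := (Valuation.mem_integer_iff _ _).2 hθ
  have hθ'O : θ' ∈ 𝒪[F] := (Valuation.mem_integer_iff _ _).2 hθ'
  have hsum : red θ + red θ' = 1 := by
    have e : red θ = IsLocalRing.residue 𝒪[F] (⟨θ, hθO⟩ : 𝒪[F]) := red_coe (⟨θ, hθO⟩ : 𝒪[F])
    have e' : red θ' = IsLocalRing.residue 𝒪[F] (⟨θ', hθ'O⟩ : 𝒪[F]) := red_coe (⟨θ', hθ'O⟩ : 𝒪[F])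
    have h1 : (⟨θ, hθO⟩ : 𝒪[F]) + ⟨θ', hθ'O⟩ = 1 := Subtype.ext hθθ'
    rw [e, e', ← map_add, h1, map_one]
  -- `red M = (1 + θ̄Ā)(1 − θ̄′Ā)⁻¹`
  have e1 : redMat M = ((1 : Matrix (Fin n) (Fin n) 𝓀[F]) + red θ • redMat A) * ((1 : Matrix (Fin n) (Fin n) 𝓀[F]) - red θ' • redMat A)⁻¹ := by
    rw [← key, Matrix.mul_nonsing_inv_cancel_right _ _ hDdet]
  have e2 : (1 : Matrix (Fin n) (Fin n) 𝓀[F]) = ((1 : Matrix (Fin n) (Fin n) 𝓀[F]) - red θ' • redMat A) * ((1 : Matrix (Fin n) (Fin n) 𝓀[F]) - red θ' • redMat A)⁻¹ := by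
    rw [Matrix.mul_nonsing_inv _ hDdet]
  calc redMat M - 1 = ((1 : Matrix (Fin n) (Fin n) 𝓀[F]) + red θ • redMat A) * ((1 : Matrix (Fin n) (Fin n) 𝓀[F]) - red θ' • redMat A)⁻¹ -
      ((1 : Matrix (Fin n) (Fin n) 𝓀[F]) - red θ' • redMat A) * ((1 : Matrix (Fin n) (Fin n) 𝓀[F]) - red θ' • redMat A)⁻¹ := by rw [← e1, ← e2]
    _ = redMat A * ((1 : Matrix (Fin n) (Fin n) 𝓀[F]) - red θ' • redMat A)⁻¹ := by
      rw [← Matrix.sub_mul]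
      congr 1
      rw [add_sub_sub_cancel, ← add_smul, hsum, one_smul]

/-- **THE HERMITIAN SHIFT KEEPS NILPOTENCY OF THE RESIDUAL CLASS**: `Ā^k = 0 ⇒ (red(φ_θ z) − 1)^k = 0` (any residue characteristic).
[cite: Kottwitz1986BaseChangeUnits, §3] [cite: Rogawski1990, §3.9 p. 32] -/
theorem pow_redMat_sub_one_eq_zero_of_hermitianShift {M A : Matrix (Fin n) (Fin n) F} (hM : ValBound 1 M) (hA : ValBound 1 A) {k : ℕ} (hnil : redMat A ^ k = 0)
    {c θ θ' : F} (hc : valuation F c < 1) (hθ : valuation F θ ≤ 1) (hθ' : valuation F θ' ≤ 1) (hθθ' : θ + θ' = 1)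
    (hMB : M * ((1 : Matrix (Fin n) (Fin n) F) + (c - θ') • A) = (1 : Matrix (Fin n) (Fin n) F) + θ • A) :
    (redMat M - 1) ^ k = 0 := by
  have hD : IsUnit ((1 : Matrix (Fin n) (Fin n) 𝓀[F]) - red θ' • redMat A) := by
    have h := isUnit_one_add_smul_of_isNilpotent ⟨k, hnil⟩ (-red θ')
    rwa [neg_smul, ← sub_eq_add_neg] at h
  obtain ⟨D, hD'⟩ := hD
  rw [redMat_sub_one_eq_of_hermitianShift hM hA ⟨k, hnil⟩ hc hθ hθ' hθθ' hMB]
  -- `Ā` commutes with `(1 − θ̄′Ā)⁻¹`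
  have hcommD : Commute (redMat A) (D : Matrix (Fin n) (Fin n) 𝓀[F]) := by
    rw [hD']
    exact (Commute.one_right _).sub_right ((Commute.refl _).smul_right _)
  have hinv : ((1 : Matrix (Fin n) (Fin n) 𝓀[F]) - red θ' • redMat A)⁻¹ = ((D⁻¹ : (Matrix (Fin n) (Fin n) 𝓀[F])ˣ) : Matrix (Fin n) (Fin n) 𝓀[F]) := by
    rw [← hD', Matrix.coe_units_inv]
  rw [hinv, (hcommD.units_inv_right).mul_pow, hnil, Matrix.zero_mul]

/-- **THE HERMITIAN SHIFT KEEPS THE JORDAN RANK**: `rank(red(φ_θ z) − 1) = rank Ā` (any residue characteristic).  ★ `rank_redMat_sub_one_eq_of_shift` is the `|2| = 1` version.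
[cite: Kottwitz1986BaseChangeUnits, §3] [cite: Rogawski1990, §4.9 Prop. 4.9.1 p. 55; §3.9 p. 32] -/
theorem rank_redMat_sub_one_eq_of_hermitianShift {M A : Matrix (Fin n) (Fin n) F} (hM : ValBound 1 M) (hA : ValBound 1 A) (hnil : IsNilpotent (redMat A))
    {c θ θ' : F} (hc : valuation F c < 1) (hθ : valuation F θ ≤ 1) (hθ' : valuation F θ' ≤ 1) (hθθ' : θ + θ' = 1)
    (hMB : M * ((1 : Matrix (Fin n) (Fin n) F) + (c - θ') • A) = (1 : Matrix (Fin n) (Fin n) F) + θ • A) :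
    (redMat M - 1).rank = (redMat A).rank := by
  have hD : IsUnit ((1 : Matrix (Fin n) (Fin n) 𝓀[F]) - red θ' • redMat A) := by
    have h := isUnit_one_add_smul_of_isNilpotent hnil (-red θ')
    rwa [neg_smul, ← sub_eq_add_neg] at h
  have hDdet : IsUnit ((1 : Matrix (Fin n) (Fin n) 𝓀[F]) - red θ' • redMat A).det := (Matrix.isUnit_iff_isUnit_det _).1 hD
  have hDinv : IsUnit ((1 : Matrix (Fin n) (Fin n) 𝓀[F]) - red θ' • redMat A)⁻¹.det := Matrix.isUnit_nonsing_inv_det _ hDdet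
  rw [redMat_sub_one_eq_of_hermitianShift hM hA hnil hc hθ hθ' hθθ' hMB, Matrix.rank_mul_eq_left_of_isUnit_det _ _ hDinv]

end Literature.NumberTheory.Automorphic

end
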